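import Summits.QuantumFields.QCD.Theses.SpectralDefectExtinction
import Literature.MathematicalPhysics.QuantumFieldTheory.QCD
import Literature.MathematicalPhysics.QuantumLattice.OverlapLocality
import Literature.MathematicalPhysics.QuantumLattice.MobilityGap
import Literature.MathematicalPhysics.QuantumLattice.LatticeToriProofs
import Literature.MathematicalPhysics.QuantumLattice.LinkHopCommutators
import Literature.Analysis.Matrix.QuadraticCombesThomas

/-!
# Stub `stub_combesThomasWilson` of line `clean-reference-determinant-locality`
(crux `Summit.QuantumFields.QCD.Theses.SpectralDefectExtinction.ExtinctionBuildsQCD`,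
item stmt-QuantumFields-8968)

**Combes–Thomas locality of the Wilson quark propagator under a coercivity floor.**  There are
universal constants `μ, C > 0` (here `μ = 1/1600`, `C = 2`) such that on every periodic lattice
`(ℤ/L)⁴`, for EVERY `SU(3)` gauge field `U`, every bare mass `m₀` and every `g ∈ (0, 1]`: if the
`r = 1` Wilson–Dirac operator `D_W = wilsonDirac (fundamentalRep (Fin 3)) U m₀ 1` is coercive,
`g² Σ|ψ|² ≤ Σ|D_W ψ|²` for all `ψ` (smallest singular value `≥ g`), then every colour–spin entry
of the quark propagator decays in the periodic taxi distance,
`|D_W⁻¹((x,i),(y,j))| ≤ (C/g) exp(−μ g ‖x − y‖₁)`.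

Proof.  (A) An abstract **coercive Combes–Thomas bound** `coercive_combes_thomas` (no
self-adjointness, no square roots): for a range-one matrix `A` on a finite pseudo-metric index set
with off-diagonal absolute row/column sums `≤ h`, a floor `g² Σ|v|² ≤ Σ|Av|²`, `0 < g`, and a
rate `θ ≥ 0` with `h(e^θ − 1) ≤ g/2`, one has `A` invertible and
`|A⁻¹ᵢⱼ| ≤ (2/g) e^{−θ dist(i,j)}`.  Fix the column `j`, `x := A⁻¹ e_j`, weights
`d_k := e^{θ dist(k,j)}`, `v := d·x`; then `A v = e_j − E v` with the Combes–Thomas perturbation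
`E_{lk} = A_{lk}(e^{θ(dist(l,j) − dist(k,j))} − 1)`, whose entries vanish where `dist(l,k) = 0`
and are `≤ (e^θ − 1)|A_{lk}|` elsewhere (`Literature.Analysis.Matrix.norm_mul_exp_sub_one_le`,
`abs_natDist_sub_natDist_le`), so Schur's test
(`Literature.Analysis.Matrix.sum_norm_sq_mulVec_le_of_rowSum_le_of_colSum_le`) gives
`Σ|Ev|² ≤ η² Σ|v|²`, `η = h(e^θ − 1) ≤ g/2`.  With `S := Σ|v|²` the floor gives
`g² S ≤ Σ|Av|² ≤ 2 + 2η² S ≤ 2 + g² S/2`, so `S ≤ 4/g²`, and the single term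
`d_i² |x_i|² ≤ S` yields `|A⁻¹ᵢⱼ| ≤ (2/g) e^{−θ dist(i,j)}`.
(B) The geometry of `D_W` for the periodic `ℓ^∞` site distance `torusDist`, uniformly in `U` and
`m₀` (adapted from `Theorems/HeatSlicedQuarksRobustYangMillsHandoverStubHighBlockLocality.lean`):
RANGE ONE (`crdl_wilsonDirac_range`) and off-site absolute row and column sums `≤ 96`
(`crdl_wilsonDirac_rowSum_le`, `crdl_wilsonDirac_colSum_le`).
(C) With `θ = g/400 ≤ 1`, `96(e^θ − 1) ≤ 192 θ < g/2` (`Real.abs_exp_sub_one_le`); (A) gives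
`(2/g) e^{−θ·torusDist x y}`, and `torusTaxiDist x y = torusDistOne x y ≤ 4 · torusDist x y`
(`torusDistOne_le_mul_torusDist`) converts the rate to `θ/4 = g/1600` in the taxi distance.

References: Combes–Thomas, Comm. Math. Phys. 34 (1973) 251 [CombesThomas1973];
Aizenman–Warzel, GSM 168, §10.3 [AizenmanWarzel2015].
-/

noncomputable section

namespace Summit.QuantumFields.QCD.Cruxes.ExtinctionBuildsQCD.CleanReferenceDeterminantLocality

open scoped BigOperators Topology ENNReal SchwartzMap Matrix Classical
open MeasureTheory Filter
open Literature.MathematicalPhysics.QuantumFieldTheory Literature.MathematicalPhysics.QuantumLattice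
  Literature.Probability.LatticeModels Literature.MathematicalPhysics.AQFT

/-! ### (A) The abstract coercive Combes–Thomas bound -/

section Abstract

open Finset Literature.Analysis.Matrix

variable {ι : Type*} [Fintype ι] [DecidableEq ι]

/-- **The coercive Combes–Thomas bound** (Combes–Thomas 1973; Aizenman–Warzel §10.3, coercive
form, no self-adjointness).  Let `dist` be an `ℕ`-valued pseudo-metric on the finite index set
`ι` and `A : Matrix ι ι ℂ` a range-one matrix (`A i j ≠ 0 → dist i j ≤ 1`) whose absolute row and
column sums over `{dist ≠ 0}` are at most `h`; assume the coercivity floor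
`g² Σ|v_i|² ≤ Σ|(Av)_i|²` for all `v` with `0 < g`, and let `θ ≥ 0` satisfy
`h(e^θ − 1) ≤ g/2`.  Then `A` is invertible and `|A⁻¹ᵢⱼ| ≤ (2/g) e^{−θ dist(i,j)}` for all
`i, j`. -/
theorem coercive_combes_thomas (dist : ι → ι → ℕ) (hd0 : ∀ i, dist i i = 0)
    (hds : ∀ i j, dist i j = dist j i) (hdt : ∀ i j k, dist i k ≤ dist i j + dist j k)
    (A : Matrix ι ι ℂ) (hrange : ∀ i j, A i j ≠ 0 → dist i j ≤ 1) (h : ℝ)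
    (hrow : ∀ i, ∑ j ∈ univ.filter (fun j => dist i j ≠ 0), ‖A i j‖ ≤ h)
    (hcol : ∀ j, ∑ i ∈ univ.filter (fun i => dist i j ≠ 0), ‖A i j‖ ≤ h)
    (g θ : ℝ) (hg : 0 < g) (hθ : 0 ≤ θ)
    (hfloor : ∀ v : ι → ℂ, g ^ 2 * ∑ i, ‖v i‖ ^ 2 ≤ ∑ i, ‖(A *ᵥ v) i‖ ^ 2)
    (hη : h * (Real.exp θ - 1) ≤ g / 2) :
    IsUnit A.det ∧ ∀ i j, ‖A⁻¹ i j‖ ≤ 2 / g * Real.exp (-(θ * dist i j)) := by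
  -- (1) `A` is injective by the floor, hence invertible
  have hdet : IsUnit A.det := by
    rw [isUnit_iff_ne_zero, Ne, ← Matrix.exists_mulVec_eq_zero_iff]
    rintro ⟨x, hx, hAx⟩
    obtain ⟨j₀, hj₀⟩ := Function.ne_iff.mp hx
    have h2 : ‖x j₀‖ ^ 2 ≤ ∑ i, ‖x i‖ ^ 2 :=
      Finset.single_le_sum (f := fun i => ‖x i‖ ^ 2) (fun i _ => by positivity) (mem_univ j₀)
    have h3 : 0 < ‖x j₀‖ ^ 2 := by positivity
    have h4 : ∑ i, ‖(A *ᵥ x) i‖ ^ 2 = 0 := by simp [hAx]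
    have h5 := hfloor x
    rw [h4] at h5
    have h6 : 0 < g ^ 2 * ∑ i, ‖x i‖ ^ 2 := mul_pos (pow_pos hg 2) (h3.trans_le h2)
    linarith
  refine ⟨hdet, fun i j => ?_⟩
  -- (2) the column `j` of `A⁻¹`
  obtain ⟨x, hx⟩ : ∃ x : ι → ℂ, x = A⁻¹ *ᵥ Pi.single j 1 := ⟨_, rfl⟩
  have hxK : ∀ k, x k = A⁻¹ k j := fun k => by
    rw [hx, Matrix.mulVec_single_one, Matrix.col_apply]
  have hAx : A *ᵥ x = Pi.single j 1 := by
    rw [hx, Matrix.mulVec_mulVec, Matrix.mul_nonsing_inv _ hdet, Matrix.one_mulVec]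
  -- (3) the weights, the weighted column and the Combes–Thomas perturbation
  set η : ℝ := h * (Real.exp θ - 1) with hηdef
  set d : ι → ℝ := fun k => Real.exp (θ * dist k j) with hd
  set v : ι → ℂ := fun k => (d k : ℂ) * x k with hv
  set Ep : Matrix ι ι ℂ := Matrix.of fun l k =>
    A l k * ((Real.exp (θ * ((dist l j : ℝ) - dist k j)) - 1 : ℝ) : ℂ) with hEp
  set S : ℝ := ∑ k, ‖v k‖ ^ 2 with hS
  have hexp0 : 0 ≤ Real.exp θ - 1 := by linarith [Real.add_one_le_exp θ]
  have hh0 : 0 ≤ h := (Finset.sum_nonneg fun j _ => norm_nonneg _).trans (hrow j)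
  have hη0 : 0 ≤ η := mul_nonneg hh0 hexp0
  have hS0 : 0 ≤ S := Finset.sum_nonneg fun k _ => by positivity
  -- the algebra: `(A v)_l + (E v)_l = d_l (A x)_l`
  have hpl : ∀ l, (A *ᵥ v) l + (Ep *ᵥ v) l = (d l : ℂ) * (A *ᵥ x) l := by
    intro l
    simp only [hEp, hv, Matrix.mulVec, dotProduct, Matrix.of_apply]
    rw [← Finset.sum_add_distrib, Finset.mul_sum]
    refine Finset.sum_congr rfl fun k _ => ?_
    have hc : Real.exp (θ * ((dist l j : ℝ) - dist k j)) * d k = d l := by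
      simp only [hd]; rw [← Real.exp_add]; ring_nf
    have hc' : ((Real.exp (θ * ((dist l j : ℝ) - dist k j)) : ℝ) : ℂ) * (d k : ℂ) =
        (d l : ℂ) := by exact_mod_cast hc
    simp only [Complex.ofReal_sub, Complex.ofReal_one]
    linear_combination (A l k * x k) * hc'
  have hdj : d j = 1 := by simp [hd, hd0]
  -- hence `A v = e_j − E v` (`d_j = 1`)
  have hAv : ∀ l, (A *ᵥ v) l = (Pi.single j 1 : ι → ℂ) l - (Ep *ᵥ v) l := by
    intro l
    rw [eq_sub_iff_add_eq, hpl l, hAx]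
    by_cases hl : l = j
    · subst hl
      rw [hdj, Complex.ofReal_one, one_mul]
    · rw [Pi.single_eq_of_ne hl, mul_zero]
  -- (4) Schur's test: `Σ|(E v)_l|² ≤ η² S`
  have hEp_le : ∀ l k, ‖Ep l k‖ ≤ (Real.exp θ - 1) * (if dist l k ≠ 0 then ‖A l k‖ else 0) := by
    intro l k
    simp only [hEp, Matrix.of_apply]
    exact norm_mul_exp_sub_one_le dist A hrange hθ l k
      (abs_natDist_sub_natDist_le dist hds hdt l k j)
  have hsum : ∀ (f₁ f₂ : ι → ℝ) (nz : ι → Prop) [DecidablePred nz],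
      (∀ k, f₁ k ≤ (Real.exp θ - 1) * (if nz k then f₂ k else 0)) →
        ∑ k ∈ univ.filter nz, f₂ k ≤ h → ∑ k, f₁ k ≤ η := by
    intro f₁ f₂ nz _ hf hb
    calc ∑ k, f₁ k ≤ ∑ k, (Real.exp θ - 1) * (if nz k then f₂ k else 0) :=
          sum_le_sum fun k _ => hf k
      _ = (Real.exp θ - 1) * ∑ k ∈ univ.filter nz, f₂ k := by rw [← mul_sum, sum_filter]
      _ ≤ η := by rw [hηdef, mul_comm h]; exact mul_le_mul_of_nonneg_left hb hexp0
  have hSp : ∑ l, ‖(Ep *ᵥ v) l‖ ^ 2 ≤ η ^ 2 * S := by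
    simpa only [← pow_two] using sum_norm_sq_mulVec_le_of_rowSum_le_of_colSum_le Ep hη0
      (fun l => hsum _ _ _ (fun k => hEp_le l k) (hrow l))
      (fun k => hsum _ _ _ (fun l => hEp_le l k) (hcol k)) v
  -- (5) `g² S ≤ Σ|(A v)_l|² ≤ 2 + 2 η² S ≤ 2 + g² S / 2`, hence `g² S ≤ 4`
  have hpt : ∀ l, ‖(A *ᵥ v) l‖ ^ 2 ≤
      2 * ‖(Pi.single j 1 : ι → ℂ) l‖ ^ 2 + 2 * ‖(Ep *ᵥ v) l‖ ^ 2 := by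
    intro l
    rw [hAv l]
    have h1 := norm_sub_le ((Pi.single j 1 : ι → ℂ) l) ((Ep *ᵥ v) l)
    have h2 := norm_nonneg ((Pi.single j 1 : ι → ℂ) l - (Ep *ᵥ v) l)
    nlinarith [sq_nonneg (‖(Pi.single j 1 : ι → ℂ) l‖ - ‖(Ep *ᵥ v) l‖),
      norm_nonneg ((Pi.single j 1 : ι → ℂ) l), norm_nonneg ((Ep *ᵥ v) l)]
  have hsingle : ∑ l, ‖(Pi.single j 1 : ι → ℂ) l‖ ^ 2 = 1 := by
    rw [Finset.sum_eq_single j (fun l _ hl => by simp [Pi.single_eq_of_ne hl]) (by simp)]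
    simp
  have hAvS : ∑ l, ‖(A *ᵥ v) l‖ ^ 2 ≤ 2 + 2 * (η ^ 2 * S) := by
    calc ∑ l, ‖(A *ᵥ v) l‖ ^ 2
        ≤ ∑ l, (2 * ‖(Pi.single j 1 : ι → ℂ) l‖ ^ 2 + 2 * ‖(Ep *ᵥ v) l‖ ^ 2) :=
          Finset.sum_le_sum fun l _ => hpt l
      _ = 2 * ∑ l, ‖(Pi.single j 1 : ι → ℂ) l‖ ^ 2 + 2 * ∑ l, ‖(Ep *ᵥ v) l‖ ^ 2 := by
          rw [Finset.sum_add_distrib, Finset.mul_sum, Finset.mul_sum]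
      _ ≤ 2 + 2 * (η ^ 2 * S) := by rw [hsingle, mul_one]; linarith [hSp]
  have hgS : g ^ 2 * S ≤ 4 := by
    have h1 : g ^ 2 * S ≤ 2 + 2 * (η ^ 2 * S) := (hfloor v).trans hAvS
    have h2 : η ^ 2 ≤ g ^ 2 / 4 := by nlinarith [hη, hη0, hg]
    have h3 : η ^ 2 * S ≤ g ^ 2 / 4 * S := mul_le_mul_of_nonneg_right h2 hS0
    linarith
  -- (6) the single term `d_i² |x_i|² ≤ S ≤ 4 / g²`
  have hvi : ‖v i‖ ^ 2 = d i ^ 2 * ‖x i‖ ^ 2 := by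
    simp only [hv]
    rw [norm_mul, Complex.norm_real, Real.norm_eq_abs, abs_of_pos (Real.exp_pos _), mul_pow]
  have hiS : ‖v i‖ ^ 2 ≤ S :=
    Finset.single_le_sum (f := fun k => ‖v k‖ ^ 2) (fun k _ => by positivity) (mem_univ i)
  have h4 : (d i * ‖x i‖) ^ 2 ≤ (2 / g) ^ 2 := by
    rw [mul_pow, ← hvi, div_pow, le_div_iff₀ (by positivity)]
    calc ‖v i‖ ^ 2 * g ^ 2 ≤ S * g ^ 2 := mul_le_mul_of_nonneg_right hiS (sq_nonneg g)
      _ ≤ 2 ^ 2 := by linarith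
  have h5 : d i * ‖x i‖ ≤ 2 / g :=
    (pow_le_pow_iff_left₀ (by positivity) (by positivity) two_ne_zero).mp h4
  rw [← hxK i, Real.exp_neg, ← div_eq_mul_inv, le_div_iff₀ (Real.exp_pos _), mul_comm]
  exact h5

end Abstract

/-! ### (B) The geometry of the Wilson–Dirac matrix: range one, off-site row/column sums `≤ 96` -/

-- adapted from Theorems/HeatSlicedQuarksRobustYangMillsHandoverStubHighBlockLocality.lean

/-- Entries of the Euclidean gamma matrices have modulus `≤ 1` (`γ_μ` is unitary:
`γ_μᴴ γ_μ = γ_μ² = 1`). -/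
private theorem crdl_norm_euclideanGamma_apply_le (μ : Fin 4) (α β : Fin 4) :
    ‖euclideanGamma μ α β‖ ≤ 1 := by
  refine entry_norm_bound_of_unitary (Matrix.mem_unitaryGroup_iff'.mpr ?_) α β
  rw [Matrix.star_eq_conjTranspose, (euclideanGamma_isHermitian μ).eq, euclideanGamma_mul_self]

/-- Entries of `r·1 ∓ γ_μ` at `r = 1` have modulus `≤ 2`. -/
private theorem crdl_norm_one_sub_gamma_apply_le (μ : Fin 4) (α β : Fin 4) :
    ‖(((1 : ℝ) : ℂ) • (1 : Matrix (Fin 4) (Fin 4) ℂ) - euclideanGamma μ) α β‖ ≤ 2 ∧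
      ‖(((1 : ℝ) : ℂ) • (1 : Matrix (Fin 4) (Fin 4) ℂ) + euclideanGamma μ) α β‖ ≤ 2 := by
  have h1 : ‖(1 : Matrix (Fin 4) (Fin 4) ℂ) α β‖ ≤ 1 := by
    rw [Matrix.one_apply]; split_ifs <;> simp
  have h2 := crdl_norm_euclideanGamma_apply_le μ α β
  simp only [Complex.ofReal_one, one_smul, Matrix.sub_apply, Matrix.add_apply]
  exact ⟨(norm_sub_le _ _).trans (by linarith), (norm_add_le _ _).trans (by linarith)⟩

variable {L : ℕ} [NeZero L]

omit [NeZero L] in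
/-- Off the diagonal, an entry of the Wilson–Dirac matrix is a sum of at most one forward and one
backward hop per direction, each of modulus `≤ ½ · 2 · 1`:
`|D_{pq}| ≤ Σ_μ (𝟙[q = p + μ̂] + 𝟙[p = q + μ̂])` (site components). -/
private theorem crdl_norm_wilsonDirac_apply_le (U : GaugeConfig 4 L SU3) (m : ℝ)
    {p q : QuarkIdx L} (hpq : p ≠ q) :
    ‖wilsonDirac (fundamentalRep (Fin 3)) U m 1 p q‖ ≤
      ∑ μ : Fin 4, ((if q.1 = Site.shift p.1 μ then (1 : ℝ) else 0) +
        (if p.1 = Site.shift q.1 μ then (1 : ℝ) else 0)) := by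
  have hU : ∀ g : SU3, ∀ a b : Fin 3, ‖fundamentalRep (Fin 3) g a b‖ ≤ 1 := fun g a b =>
    entry_norm_bound_of_unitary (fundamentalRep_mem_unitaryGroup g) a b
  simp only [wilsonDirac, Matrix.of_apply, if_neg hpq, zero_sub, norm_neg, norm_mul]
  have hhalf : ‖(1 / 2 : ℂ)‖ = 1 / 2 := by norm_num
  rw [hhalf]
  have hterm : ∀ μ : Fin 4,
      ‖(if q.1 = Site.shift p.1 μ then
            (((1 : ℝ) : ℂ) • (1 : Matrix (Fin 4) (Fin 4) ℂ) - euclideanGamma μ) p.2.2 q.2.2 *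
              fundamentalRep (Fin 3) (U (p.1, μ)) p.2.1 q.2.1 else 0) +
          (if p.1 = Site.shift q.1 μ then
            (((1 : ℝ) : ℂ) • (1 : Matrix (Fin 4) (Fin 4) ℂ) + euclideanGamma μ) p.2.2 q.2.2 *
              fundamentalRep (Fin 3) (U (q.1, μ))⁻¹ p.2.1 q.2.1 else 0)‖ ≤
        2 * ((if q.1 = Site.shift p.1 μ then (1 : ℝ) else 0) +
          (if p.1 = Site.shift q.1 μ then (1 : ℝ) else 0)) := by
    intro μ
    obtain ⟨hm, hp⟩ := crdl_norm_one_sub_gamma_apply_le μ p.2.2 q.2.2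
    refine (norm_add_le _ _).trans ?_
    rw [mul_add]
    refine add_le_add ?_ ?_
    · split_ifs with hc
      · rw [norm_mul]
        calc _ ≤ 2 * 1 := mul_le_mul hm (hU _ _ _) (norm_nonneg _) zero_le_two
          _ = 2 * 1 := rfl
      · simp
    · split_ifs with hc
      · rw [norm_mul]
        calc _ ≤ 2 * 1 := mul_le_mul hp (hU _ _ _) (norm_nonneg _) zero_le_two
          _ = 2 * 1 := rfl
      · simp
  calc 1 / 2 * ‖∑ μ : Fin 4, _‖ ≤ 1 / 2 * ∑ μ : Fin 4,
        2 * ((if q.1 = Site.shift p.1 μ then (1 : ℝ) else 0) +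
          (if p.1 = Site.shift q.1 μ then (1 : ℝ) else 0)) := by
        refine mul_le_mul_of_nonneg_left
          ((norm_sum_le _ _).trans (Finset.sum_le_sum fun μ _ => hterm μ)) ?_
        norm_num
    _ = _ := by rw [← Finset.mul_sum]; ring

/-- **Range one**: `D_{pq} ≠ 0` forces `torusDist p q ≤ 1` (site components). -/
private theorem crdl_wilsonDirac_range (U : GaugeConfig 4 L SU3) (m : ℝ) (p q : QuarkIdx L)
    (h : wilsonDirac (fundamentalRep (Fin 3)) U m 1 p q ≠ 0) : torusDist p.1 q.1 ≤ 1 := by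
  by_contra hd
  rw [not_le] at hd
  have hpq : p ≠ q := by
    rintro rfl
    rw [torusDist_self] at hd
    exact Nat.not_succ_le_zero 1 hd
  have h1 : ∀ μ : Fin 4, ¬ q.1 = Site.shift p.1 μ := by
    intro μ hq
    have := torusDist_add_single_le_one p.1 μ
    rw [torusDist_comm', ← Literature.MathematicalPhysics.QuantumFieldTheory.Site.shift, ← hq] at this
    omega
  have h2 : ∀ μ : Fin 4, ¬ p.1 = Site.shift q.1 μ := by
    intro μ hp
    have := torusDist_add_single_le_one q.1 μ
    rw [← Literature.MathematicalPhysics.QuantumFieldTheory.Site.shift, ← hp] at this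
    omega
  have hle := crdl_norm_wilsonDirac_apply_le U m hpq
  simp only [if_neg (h1 _), if_neg (h2 _), add_zero, Finset.sum_const_zero] at hle
  exact h (norm_le_zero_iff.mp hle)

/-- Counting: `#{(y, b, β) | y = s} = 12`. -/
private theorem crdl_sum_ite_fst_eq (s : TorusSite 4 L) :
    ∑ q : QuarkIdx L, (if q.1 = s then (1 : ℝ) else 0) = 12 := by
  rw [Fintype.sum_prod_type, Finset.sum_eq_single s (fun y _ hy => by simp [hy]) (by simp)]
  simp only [if_true, Finset.sum_const, Finset.card_univ, Fintype.card_prod, Fintype.card_fin,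
    nsmul_eq_mul, mul_one]
  norm_num

/-- **Row sums**: `Σ_{q : dist(p,q) ≠ 0} |D_{pq}| ≤ 96`. -/
private theorem crdl_wilsonDirac_rowSum_le (U : GaugeConfig 4 L SU3) (m : ℝ) (p : QuarkIdx L) :
    ∑ q ∈ Finset.univ.filter (fun q : QuarkIdx L => torusDist p.1 q.1 ≠ 0),
      ‖wilsonDirac (fundamentalRep (Fin 3)) U m 1 p q‖ ≤ 96 := by
  calc _ ≤ ∑ q ∈ Finset.univ.filter (fun q : QuarkIdx L => torusDist p.1 q.1 ≠ 0),
        ∑ μ : Fin 4, ((if q.1 = Site.shift p.1 μ then (1 : ℝ) else 0) +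
          (if p.1 = Site.shift q.1 μ then (1 : ℝ) else 0)) := by
        refine Finset.sum_le_sum fun q hq => crdl_norm_wilsonDirac_apply_le U m ?_
        rintro rfl
        rw [Finset.mem_filter, torusDist_self] at hq
        exact hq.2 rfl
    _ ≤ ∑ q : QuarkIdx L,
        ∑ μ : Fin 4, ((if q.1 = Site.shift p.1 μ then (1 : ℝ) else 0) +
          (if p.1 = Site.shift q.1 μ then (1 : ℝ) else 0)) :=
        Finset.sum_le_univ_sum_of_nonneg fun q => Finset.sum_nonneg fun μ _ => by positivity
    _ = ∑ μ : Fin 4, ((12 : ℝ) + 12) := by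
        rw [Finset.sum_comm]
        refine Finset.sum_congr rfl fun μ _ => ?_
        rw [Finset.sum_add_distrib, crdl_sum_ite_fst_eq]
        simp_rw [eq_shift_iff p.1 _ μ]
        rw [crdl_sum_ite_fst_eq]
    _ = 96 := by norm_num

/-- **Column sums**: `Σ_{p : dist(p,q) ≠ 0} |D_{pq}| ≤ 96`. -/
private theorem crdl_wilsonDirac_colSum_le (U : GaugeConfig 4 L SU3) (m : ℝ) (q : QuarkIdx L) :
    ∑ p ∈ Finset.univ.filter (fun p : QuarkIdx L => torusDist p.1 q.1 ≠ 0),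
      ‖wilsonDirac (fundamentalRep (Fin 3)) U m 1 p q‖ ≤ 96 := by
  calc _ ≤ ∑ p ∈ Finset.univ.filter (fun p : QuarkIdx L => torusDist p.1 q.1 ≠ 0),
        ∑ μ : Fin 4, ((if q.1 = Site.shift p.1 μ then (1 : ℝ) else 0) +
          (if p.1 = Site.shift q.1 μ then (1 : ℝ) else 0)) := by
        refine Finset.sum_le_sum fun p hp => crdl_norm_wilsonDirac_apply_le U m ?_
        rintro rfl
        rw [Finset.mem_filter, torusDist_self] at hp
        exact hp.2 rfl
    _ ≤ ∑ p : QuarkIdx L,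
        ∑ μ : Fin 4, ((if q.1 = Site.shift p.1 μ then (1 : ℝ) else 0) +
          (if p.1 = Site.shift q.1 μ then (1 : ℝ) else 0)) :=
        Finset.sum_le_univ_sum_of_nonneg fun p => Finset.sum_nonneg fun μ _ => by positivity
    _ = ∑ μ : Fin 4, ((12 : ℝ) + 12) := by
        rw [Finset.sum_comm]
        refine Finset.sum_congr rfl fun μ _ => ?_
        rw [Finset.sum_add_distrib, crdl_sum_ite_fst_eq]
        simp_rw [eq_shift_iff q.1 _ μ]
        rw [crdl_sum_ite_fst_eq]
    _ = 96 := by norm_num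

/-! ### (C) The stub -/

/-- **S1 — Combes–Thomas for the Wilson–Dirac operator, coercivity form** (registered stub of line
`clean-reference-determinant-locality`).  With `μ = 1/1600` and `C = 2`: on every torus, for every
`SU(3)` field `U`, every bare mass `m₀` and every `g ∈ (0, 1]`, if
`g² Σ|ψ|² ≤ Σ|D_W(U,m₀,1)ψ|²` for all `ψ`, then every colour–spin entry of the quark propagator
obeys `‖D_W⁻¹(x,i;y,j)‖ ≤ (C/g) exp(−μ g ‖x−y‖₁)` in the periodic taxi distance.  Coercive
Combes–Thomas (`coercive_combes_thomas`) on `QuarkIdx L` with the site metric `torusDist`,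
`h = 96`, `θ = g/400`, then `torusTaxiDist ≤ 4 · torusDist`. -/
theorem stub_combesThomasWilson :
    ∃ μ C : ℝ, 0 < μ ∧ 0 < C ∧ ∀ (L : ℕ) [NeZero L] (U : GaugeConfig 4 L SU3) (m₀ g : ℝ),
      0 < g → g ≤ 1 →
      (∀ ψ : QuarkIdx L → ℂ, g ^ 2 * ∑ i, ‖ψ i‖ ^ 2 ≤
          ∑ i, ‖(wilsonDirac (fundamentalRep (Fin 3)) U m₀ 1 *ᵥ ψ) i‖ ^ 2) →
      ∀ (x y : TorusSite 4 L) (i j : Fin 3 × Fin 4),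
        ‖(wilsonDirac (fundamentalRep (Fin 3)) U m₀ 1)⁻¹ (x, i) (y, j)‖ ≤
          C / g * Real.exp (-(μ * g * (torusTaxiDist x y : ℝ))) := by
  refine ⟨1 / 1600, 2, by norm_num, by norm_num, ?_⟩
  intro L _ U m₀ g hg hg1 hfloor x y i j
  -- the Combes–Thomas rate `θ = g / 400`, so that `η = 96 (e^θ − 1) ≤ g / 2`
  set θ : ℝ := g / 400 with hθ
  have hθ0 : 0 ≤ θ := by positivity
  have hθ1 : |θ| ≤ 1 := by rw [abs_of_nonneg hθ0, hθ]; linarith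
  have hη : 96 * (Real.exp θ - 1) ≤ g / 2 := by
    have h1 := Real.abs_exp_sub_one_le hθ1
    rw [abs_of_nonneg hθ0, abs_of_nonneg (by linarith [Real.add_one_le_exp θ])] at h1
    rw [hθ] at h1 ⊢
    linarith
  -- the abstract coercive Combes–Thomas bound on `QuarkIdx L` with the site metric `torusDist`
  obtain ⟨-, hB⟩ := coercive_combes_thomas
    (fun p q : QuarkIdx L => torusDist p.1 q.1) (fun p => torusDist_self p.1)
    (fun p q => torusDist_comm' p.1 q.1) (fun p q r => torusDist_triangle' p.1 q.1 r.1)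
    (wilsonDirac (fundamentalRep (Fin 3)) U m₀ 1) (fun p q h => crdl_wilsonDirac_range U m₀ p q h)
    96 (crdl_wilsonDirac_rowSum_le U m₀) (crdl_wilsonDirac_colSum_le U m₀) g θ hg hθ0 hfloor hη
  have h : ‖(wilsonDirac (fundamentalRep (Fin 3)) U m₀ 1)⁻¹ (x, i) (y, j)‖ ≤
      2 / g * Real.exp (-(θ * (torusDist x y : ℝ))) := hB (x, i) (y, j)
  refine h.trans (mul_le_mul_of_nonneg_left ?_ (by positivity))
  rw [Real.exp_le_exp, neg_le_neg_iff]
  -- `torusTaxiDist = torusDistOne ≤ 4 · torusDist`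
  have htaxi₀ : torusTaxiDist x y ≤ 4 * torusDist (Ls := fun _ : Fin 4 => L) x y :=
    torusDistOne_le_mul_torusDist (Ls := fun _ : Fin 4 => L) x y
  have htaxi : (torusTaxiDist x y : ℝ) ≤ 4 * (torusDist (Ls := fun _ : Fin 4 => L) x y : ℝ) := by
    exact_mod_cast htaxi₀
  have hmul := mul_le_mul_of_nonneg_left htaxi hg.le
  rw [hθ]
  nlinarith [hmul]

end Summit.QuantumFields.QCD.Cruxes.ExtinctionBuildsQCD.CleanReferenceDeterminantLocality
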